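import Summits.QuantumFields.BalabanUV.Beta.FP.ColourDoublingKkt
import Summits.QuantumFields.BalabanUV.Beta.FP.NestedStepLawOneShotJets

/-!
# `BalabanUV.Beta.FP.ColourDoublingBlocks` — road «FP» for binder row D1, ROUTE T, option (δ) «LIFT» (R-FP-54′):
# **KRONECKER ∕ RE-INDEXING BOOKKEEPING FOR LIFTED BORDERED SYSTEMS** — the blocks of the `1`-lifted fine bordered inverse
# (`flucCov ∕ minOp ∕ minOpL ∕ effForm` of `kkt (1⊗H) [1⊗Q; 1⊗τ]` are the re-indexed lifts of the stripped ones), products with one-sided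
# `submatrix`, the linear structure in the right Kronecker factor under a fixed re-indexing, `secondVar` under `submatrix`, and a doubly
# bordered matrix with a re-indexed last row block.  The simp kit of `NestedStepLawOneShotJetsGraded` (all [folklore]; `ext` + `simp`).

HONEST DEPENDENCY (page 1, mandatory): continuum YM on T⁴ ⇐ BetaPertH ∧ nine spine estimates (0/9 proved); BetaPertH ⇐ (D1) ∧ (D4) ∧ CAP+tail;
G-an2-4 gates asym, D1 and NE2/3/4.  HONEST FRAMING (cell contract, verbatim): «discharging `BetaPertH` makes Bałaban's UV stability UNCONDITIONAL —
a real constructive-QFT result; it is NOT the continuum limit and NOT the Clay problem.»  ABSOLUTE RULE (cell charter, verbatim): «No internally-minted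
statement may enter as a cited fact. Every hypothesis is either kernel-proved in this package or a verbatim quotation of a PUBLISHED theorem with page
reference. The manuscript(s) under audit are NOT citable for their own disputed steps — they are the thing under adjudication; programme-internal
(2001/route/tribunal) claims are never citable.»  No `def`, no `def … : Prop`, nothing cited, 0 sorry; 0 estimates; 0∕4 row-D1 binders; NOT (T-ID),
NOT SDF, NOT D1, NOT BetaPertH, NOT continuum, NOT Clay.  Road «FP» OWNER, b2b-balaban-beta-d1-p3 gen 18, 2026-08-22.  No existing file touched.
-/

noncomputable section

namespace Summit.QuantumFields.BalabanUV.Beta.FP.ColourDoublingBlocks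

open Matrix
open scoped Kronecker
open Literature.MathematicalPhysics.QuantumFieldTheory.Balaban1983to89.Beta.Composition (kkt)
open Literature.MathematicalPhysics.QuantumFieldTheory.Balaban1983to89.Beta.CompositionSingular (effForm flucCov minOp minOpL)
open Summit.QuantumFields.BalabanUV.Beta.D1BFx.LogDetSecondVariation (secondVar)
open Summit.QuantumFields.BalabanUV.Beta.D1BFx.ColourLift (e₂ e₃ e₂_symm_inl e₂_symm_inr e₃_symm_inl e₃_symm_inr_inl e₃_symm_inr_inr
  kkt_kronecker_symm kronecker_transpose' neg_kronecker kronecker_neg det_kkt_lift_ne_zero det_one_kronecker_ne_zero)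
open Summit.QuantumFields.BalabanUV.Beta.FP.ColourDoubling (secondVar_kronecker_lift)
open Summit.QuantumFields.BalabanUV.Beta.FP.ColourDoublingKkt (secondVar_reindex secondVar_kkt_lift_strip secondVar_kkt_lift_strip_zeroSlice)

/-! ## §1 Kronecker ∕ re-indexing bookkeeping (all [folklore]; `ext` + `simp`) -/


variable {l ν μ ρ : Type*}

/-- [folklore] `M.submatrix f id * N = (M * N).submatrix f id`. -/
theorem submatrix_id_mul {m n p q : Type*} [Fintype n] (M : Matrix m n ℝ) (N : Matrix n p ℝ) (f : q → m) :
    M.submatrix f id * N = (M * N).submatrix f id := by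
  ext i j; simp [Matrix.mul_apply]

/-- [folklore] `M * N.submatrix id g = (M * N).submatrix id g`. -/
theorem mul_submatrix_id {m n p q : Type*} [Fintype n] (M : Matrix m n ℝ) (N : Matrix n p ℝ) (g : q → p) :
    M * N.submatrix id g = (M * N).submatrix id g := by
  ext i j; simp [Matrix.mul_apply]

/-- [folklore] the `(μ,μ)` block of an `e₂`-re-indexed lift is the lift of the block. -/
theorem toBlocks₁₁_lift (a : Matrix l l ℝ) (X : Matrix (μ ⊕ ρ) (μ ⊕ ρ) ℝ) :
    ((a ⊗ₖ X).submatrix (e₂ l μ ρ).symm (e₂ l μ ρ).symm).toBlocks₁₁ = a ⊗ₖ X.toBlocks₁₁ := by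
  ext ⟨i, x⟩ ⟨j, y⟩; simp [Matrix.toBlocks₁₁, Matrix.kroneckerMap_apply]

/-- [folklore] blocks of an `e₃`-re-indexed lift, `(1,1)`. -/
theorem toBlocks₁₁_lift₃ (a : Matrix l l ℝ) (X : Matrix (ν ⊕ (μ ⊕ ρ)) (ν ⊕ (μ ⊕ ρ)) ℝ) :
    ((a ⊗ₖ X).submatrix (e₃ l ν μ ρ).symm (e₃ l ν μ ρ).symm).toBlocks₁₁ = a ⊗ₖ X.toBlocks₁₁ := by
  ext ⟨i, x⟩ ⟨j, y⟩; simp [Matrix.toBlocks₁₁, Matrix.kroneckerMap_apply]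

/-- [folklore] blocks of an `e₃`-re-indexed lift, `(1,2)`. -/
theorem toBlocks₁₂_lift₃ (a : Matrix l l ℝ) (X : Matrix (ν ⊕ (μ ⊕ ρ)) (ν ⊕ (μ ⊕ ρ)) ℝ) :
    ((a ⊗ₖ X).submatrix (e₃ l ν μ ρ).symm (e₃ l ν μ ρ).symm).toBlocks₁₂ = (a ⊗ₖ X.toBlocks₁₂).submatrix id (e₂ l μ ρ).symm := by
  ext ⟨i, x⟩ b; rcases b with ⟨j, y⟩ | ⟨j, r⟩ <;> simp [Matrix.toBlocks₁₂, Matrix.kroneckerMap_apply]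

/-- [folklore] blocks of an `e₃`-re-indexed lift, `(2,1)`. -/
theorem toBlocks₂₁_lift₃ (a : Matrix l l ℝ) (X : Matrix (ν ⊕ (μ ⊕ ρ)) (ν ⊕ (μ ⊕ ρ)) ℝ) :
    ((a ⊗ₖ X).submatrix (e₃ l ν μ ρ).symm (e₃ l ν μ ρ).symm).toBlocks₂₁ = (a ⊗ₖ X.toBlocks₂₁).submatrix (e₂ l μ ρ).symm id := by
  ext b ⟨j, y⟩; rcases b with ⟨i, x⟩ | ⟨i, r⟩ <;> simp [Matrix.toBlocks₂₁, Matrix.kroneckerMap_apply]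

/-- [folklore] blocks of an `e₃`-re-indexed lift, `(2,2)`. -/
theorem toBlocks₂₂_lift₃ (a : Matrix l l ℝ) (X : Matrix (ν ⊕ (μ ⊕ ρ)) (ν ⊕ (μ ⊕ ρ)) ℝ) :
    ((a ⊗ₖ X).submatrix (e₃ l ν μ ρ).symm (e₃ l ν μ ρ).symm).toBlocks₂₂
      = (a ⊗ₖ X.toBlocks₂₂).submatrix (e₂ l μ ρ).symm (e₂ l μ ρ).symm := by
  ext b b'; rcases b with ⟨i, x⟩ | ⟨i, r⟩ <;> rcases b' with ⟨j, y⟩ | ⟨j, r'⟩ <;> simp [Matrix.toBlocks₂₂, Matrix.kroneckerMap_apply]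

variable [Fintype l] [Fintype ν] [Fintype μ] [Fintype ρ] [DecidableEq l] [DecidableEq ν] [DecidableEq μ] [DecidableEq ρ]

/-- [folklore] the inverse of the `1`-lifted doubly bordered matrix is the `e₃`-re-indexed lift of the inverse. -/
theorem kkt_one_lift_inv (H : Matrix ν ν ℝ) (Q : Matrix μ ν ℝ) (τ : Matrix ρ ν ℝ) :
    (kkt ((1 : Matrix l l ℝ) ⊗ₖ H) (fromRows ((1 : Matrix l l ℝ) ⊗ₖ Q) ((1 : Matrix l l ℝ) ⊗ₖ τ)))⁻¹
      = ((1 : Matrix l l ℝ) ⊗ₖ (kkt H (fromRows Q τ))⁻¹).submatrix (e₃ l ν μ ρ).symm (e₃ l ν μ ρ).symm := by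
  rw [kkt_kronecker_symm Matrix.transpose_one, Matrix.reindex_apply, Matrix.inv_submatrix_equiv, Matrix.inv_kronecker, inv_one]

/-- [folklore] **`flucCov` of the `1`-lifted fine system is the lift of `flucCov`.** -/
theorem flucCov_lift (H : Matrix ν ν ℝ) (Q : Matrix μ ν ℝ) (τ : Matrix ρ ν ℝ) :
    flucCov ((1 : Matrix l l ℝ) ⊗ₖ H) (fromRows ((1 : Matrix l l ℝ) ⊗ₖ Q) ((1 : Matrix l l ℝ) ⊗ₖ τ))
      = (1 : Matrix l l ℝ) ⊗ₖ flucCov H (fromRows Q τ) := by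
  unfold flucCov; rw [kkt_one_lift_inv, toBlocks₁₁_lift₃]

/-- [folklore] `minOp` of the `1`-lifted fine system. -/
theorem minOp_lift (H : Matrix ν ν ℝ) (Q : Matrix μ ν ℝ) (τ : Matrix ρ ν ℝ) :
    minOp ((1 : Matrix l l ℝ) ⊗ₖ H) (fromRows ((1 : Matrix l l ℝ) ⊗ₖ Q) ((1 : Matrix l l ℝ) ⊗ₖ τ))
      = ((1 : Matrix l l ℝ) ⊗ₖ minOp H (fromRows Q τ)).submatrix id (e₂ l μ ρ).symm := by
  unfold minOp; rw [kkt_one_lift_inv, toBlocks₁₂_lift₃]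

/-- [folklore] `minOpL` of the `1`-lifted fine system. -/
theorem minOpL_lift (H : Matrix ν ν ℝ) (Q : Matrix μ ν ℝ) (τ : Matrix ρ ν ℝ) :
    minOpL ((1 : Matrix l l ℝ) ⊗ₖ H) (fromRows ((1 : Matrix l l ℝ) ⊗ₖ Q) ((1 : Matrix l l ℝ) ⊗ₖ τ))
      = ((1 : Matrix l l ℝ) ⊗ₖ minOpL H (fromRows Q τ)).submatrix (e₂ l μ ρ).symm id := by
  unfold minOpL; rw [kkt_one_lift_inv, toBlocks₂₁_lift₃]

/-- [folklore] `effForm` of the `1`-lifted fine system. -/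
theorem effForm_lift (H : Matrix ν ν ℝ) (Q : Matrix μ ν ℝ) (τ : Matrix ρ ν ℝ) :
    effForm ((1 : Matrix l l ℝ) ⊗ₖ H) (fromRows ((1 : Matrix l l ℝ) ⊗ₖ Q) ((1 : Matrix l l ℝ) ⊗ₖ τ))
      = ((1 : Matrix l l ℝ) ⊗ₖ effForm H (fromRows Q τ)).submatrix (e₂ l μ ρ).symm (e₂ l μ ρ).symm := by
  unfold effForm; rw [kkt_one_lift_inv, toBlocks₂₂_lift₃, kronecker_neg]; rfl

omit [Fintype l] [Fintype ν] [Fintype μ] [Fintype ρ] [DecidableEq l] [DecidableEq ν] [DecidableEq μ] [DecidableEq ρ] in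
/-- [folklore] `fromRows` of lifts is the `e₂`-re-indexed lift of `fromRows`. -/
theorem fromRows_lift (a : Matrix l l ℝ) (Q : Matrix μ ν ℝ) (T : Matrix ρ ν ℝ) :
    fromRows (a ⊗ₖ Q) (a ⊗ₖ T) = (a ⊗ₖ fromRows Q T).submatrix (e₂ l μ ρ).symm id := by
  ext b ⟨j, y⟩; rcases b with ⟨i, x⟩ | ⟨i, r⟩ <;> simp [Matrix.kroneckerMap_apply, Matrix.fromRows]

omit [Fintype l] [Fintype ν] [Fintype μ] [Fintype ρ] [DecidableEq l] [DecidableEq ν] [DecidableEq μ] [DecidableEq ρ] in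
/-- [folklore] `fromRows (a ⊗ Q) 0` is the `e₂`-re-indexed lift of `fromRows Q 0`. -/
theorem fromRows_lift_zero (a : Matrix l l ℝ) (Q : Matrix μ ν ℝ) :
    fromRows (a ⊗ₖ Q) (0 : Matrix (l × ρ) (l × ν) ℝ) = (a ⊗ₖ fromRows Q (0 : Matrix ρ ν ℝ)).submatrix (e₂ l μ ρ).symm id := by
  rw [← fromRows_lift, Matrix.kronecker_zero]

omit [Fintype l] [Fintype ν] [Fintype μ] [Fintype ρ] [DecidableEq l] [DecidableEq ν] [DecidableEq μ] [DecidableEq ρ] in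
/-- [folklore] `(−a) ⊗ X = a ⊗ (−X)`. -/
theorem neg_kronecker_comm {m n p q : Type*} (a : Matrix m n ℝ) (X : Matrix p q ℝ) : (-a) ⊗ₖ X = a ⊗ₖ (-X) := by
  rw [neg_kronecker, kronecker_neg]

omit [Fintype l] [Fintype ν] [Fintype μ] [Fintype ρ] [DecidableEq l] [DecidableEq ν] [DecidableEq μ] [DecidableEq ρ] in
/-- [folklore] addition in the right factor under a fixed re-indexing. -/
theorem add_lift {m n p q r t : Type*} (a : Matrix m n ℝ) (X Y : Matrix p q ℝ) (f : r → m × p) (g : t → n × q) :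
    (a ⊗ₖ X).submatrix f g + (a ⊗ₖ Y).submatrix f g = (a ⊗ₖ (X + Y)).submatrix f g := by
  rw [Matrix.kronecker_add]; rfl

omit [Fintype l] [Fintype ν] [Fintype μ] [Fintype ρ] [DecidableEq l] [DecidableEq ν] [DecidableEq μ] [DecidableEq ρ] in
/-- [folklore] subtraction in the right factor under a fixed re-indexing. -/
theorem sub_lift {m n p q r t : Type*} (a : Matrix m n ℝ) (X Y : Matrix p q ℝ) (f : r → m × p) (g : t → n × q) :
    (a ⊗ₖ X).submatrix f g - (a ⊗ₖ Y).submatrix f g = (a ⊗ₖ (X - Y)).submatrix f g := by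
  rw [sub_eq_add_neg, sub_eq_add_neg, Matrix.kronecker_add, kronecker_neg]; rfl

omit [Fintype l] [Fintype ν] [Fintype μ] [Fintype ρ] [DecidableEq l] [DecidableEq ν] [DecidableEq μ] [DecidableEq ρ] in
/-- [folklore] negation in the right factor under a fixed re-indexing. -/
theorem neg_lift {m n p q r t : Type*} (a : Matrix m n ℝ) (X : Matrix p q ℝ) (f : r → m × p) (g : t → n × q) :
    -((a ⊗ₖ X).submatrix f g) = (a ⊗ₖ (-X)).submatrix f g := by
  rw [kronecker_neg]; rfl

omit [Fintype l] [Fintype ν] [Fintype μ] [Fintype ρ] [DecidableEq l] [DecidableEq ν] [DecidableEq μ] [DecidableEq ρ] in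
/-- [folklore] scalars in the right factor under a fixed re-indexing. -/
theorem smul_lift {m n p q r t : Type*} (s : ℝ) (a : Matrix m n ℝ) (X : Matrix p q ℝ) (f : r → m × p) (g : t → n × q) :
    s • (a ⊗ₖ X).submatrix f g = (a ⊗ₖ (s • X)).submatrix f g := by
  rw [Matrix.kronecker_smul]; rfl

omit [Fintype l] [Fintype ν] [Fintype μ] [Fintype ρ] [DecidableEq l] [DecidableEq ν] [DecidableEq μ] [DecidableEq ρ] in
/-- [folklore] `a ⊗ X − a ⊗ Y = a ⊗ (X − Y)`. -/
theorem kron_sub {m n p q : Type*} (a : Matrix m n ℝ) (X Y : Matrix p q ℝ) : a ⊗ₖ X - a ⊗ₖ Y = a ⊗ₖ (X - Y) := by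
  rw [sub_eq_add_neg, sub_eq_add_neg, Matrix.kronecker_add, kronecker_neg]

omit [Fintype l] [Fintype ν] [Fintype μ] [Fintype ρ] [DecidableEq l] [DecidableEq ν] [DecidableEq μ] [DecidableEq ρ] in
/-- [folklore] `a ⊗ X + a ⊗ Y = a ⊗ (X + Y)`. -/
theorem kron_add {m n p q : Type*} (a : Matrix m n ℝ) (X Y : Matrix p q ℝ) : a ⊗ₖ X + a ⊗ₖ Y = a ⊗ₖ (X + Y) :=
  (Matrix.kronecker_add a X Y).symm

omit [Fintype l] [Fintype ν] [Fintype μ] [Fintype ρ] [DecidableEq l] [DecidableEq ν] [DecidableEq μ] [DecidableEq ρ] in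
/-- [folklore] `−(a ⊗ X) = a ⊗ (−X)`. -/
theorem kron_neg {m n p q : Type*} (a : Matrix m n ℝ) (X : Matrix p q ℝ) : -(a ⊗ₖ X) = a ⊗ₖ (-X) := (kronecker_neg a X).symm

omit [Fintype l] [Fintype ν] [Fintype μ] [Fintype ρ] [DecidableEq l] [DecidableEq ν] [DecidableEq μ] [DecidableEq ρ] in
/-- [folklore] `s • (a ⊗ X) = a ⊗ (s • X)`. -/
theorem kron_smul {m n p q : Type*} (s : ℝ) (a : Matrix m n ℝ) (X : Matrix p q ℝ) : s • (a ⊗ₖ X) = a ⊗ₖ (s • X) :=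
  (Matrix.kronecker_smul s a X).symm

omit [DecidableEq l] [DecidableEq ν] [DecidableEq μ] [DecidableEq ρ] [Fintype μ] [Fintype ρ] in
/-- [folklore] `secondVar` is invariant under a simultaneous `submatrix` by one equivalence. -/
theorem secondVar_submatrix_equiv {ι κ : Type*} [Fintype ι] [Fintype κ] [DecidableEq ι] [DecidableEq κ] (e : κ ≃ ι) (A₀ A₁ A₂ : Matrix ι ι ℝ) :
    secondVar (A₀.submatrix e e) (A₁.submatrix e e) (A₂.submatrix e e) = secondVar A₀ A₁ A₂ := by
  have h := secondVar_reindex e.symm A₀ A₁ A₂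
  simp only [Matrix.reindex_apply, Equiv.symm_symm] at h
  exact h

omit [DecidableEq l] [DecidableEq ν] [DecidableEq μ] [DecidableEq ρ] [Fintype l] [Fintype ν] [Fintype μ] [Fintype ρ] in
/-- [folklore] a doubly bordered matrix whose LAST row block is re-indexed is the re-indexed doubly bordered matrix. -/
theorem kkt_fromRows_submatrix {ρ' : Type*} (K : Matrix ν ν ℝ) (Q : Matrix μ ν ℝ) (T : Matrix ρ ν ℝ) (e : ρ' ≃ ρ) :
    kkt K (fromRows Q (T.submatrix e id))
      = (kkt K (fromRows Q T)).submatrix (Equiv.sumCongr (Equiv.refl ν) (Equiv.sumCongr (Equiv.refl μ) e))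
          (Equiv.sumCongr (Equiv.refl ν) (Equiv.sumCongr (Equiv.refl μ) e)) := by
  ext a b
  rcases a with x | (y | r) <;> rcases b with x' | (y' | r') <;> simp [kkt, Matrix.fromBlocks, Matrix.fromRows]


end Summit.QuantumFields.BalabanUV.Beta.FP.ColourDoublingBlocks

end
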